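import Mathlib
import Literature.Analysis.Potential.RieszKernelFourierPairingProofs
import HarnessLib

/-!
# Crux `GaussianLimitIsFree` (item stmt-CriticalPhenomena-2601), line `registered` (v6):
# stub `stub_sobolev_riesz_duality` — the `H¹`–`Ḣ^{-s}` duality estimate for the Riesz pairing

For `1/2 < Δ ≤ 1` there is `C > 0` with
`|∫ h f| ≤ C · (∫ h² + ∫ ‖Dh‖²)^{1/2} · (∬ f(x)‖x−y‖^{-2Δ}f(y))^{1/2}` for all real Schwartz
`h, f` on `ℝ³`.  Proof (Fourier side, `α = 2Δ ∈ (1, 2]`):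
(i) Parseval for the complexified test functions, `|∫ h f| ≤ ∫ |ĥ| |f̂|`
(`SchwartzMap.integral_inner_fourier_fourier`);
(ii) Cauchy–Schwarz with the weights `‖ξ‖^{(3−α)/2}`, `‖ξ‖^{-(3−α)/2}`
(`integral_mul_le_Lp_mul_Lq_of_nonneg`);
(iii) `‖ξ‖^{3−α} ≤ 1 + ‖ξ‖²`, Plancherel (`SchwartzMap.integral_norm_sq_fourier`) and the symbol
rule `𝓕(∂ⱼh) = 2πi ξⱼ ĥ` (`SchwartzMap.fourier_lineDerivOp_eq`) give
`∫ ‖ξ‖^{3−α}|ĥ|² ≤ ∫ h² + (3/4π²) ∫ ‖Dh‖²`;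
(iv) `∫ ‖ξ‖^{α−3}|f̂|² = c⁻¹ ∬ f(x)‖x−y‖^{-α}f(y)` by the tree theorem
`Literature.Analysis.Potential.rieszKernel_fourier_pairing` (Stein 1970, V §1.1).
The constant is `C = c^{-1/2}`.
-/

noncomputable section

namespace Summit.CriticalPhenomena.Ising3DConformalLimit.Cruxes.GaussianLimitIsFree.Birth

open MeasureTheory Filter Set FourierTransform
open scoped BigOperators Topology ComplexConjugate Real SchwartzMap LineDeriv InnerProductSpace
open Literature.MathematicalPhysics.QuantumLattice (ofRealTest ofRealTest_apply)

/-! ### Step (ii): Cauchy–Schwarz in `sqrt` form -/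

/-- Cauchy–Schwarz for integrals of nonnegative square-integrable functions, in `√` form.
[folklore] -/
theorem integral_mul_le_sqrt_mul_sqrt {X : Type*} [MeasurableSpace X] {μ : Measure X}
    {F G : X → ℝ} (hF0 : 0 ≤ᵐ[μ] F) (hG0 : 0 ≤ᵐ[μ] G) (hF : MemLp F 2 μ) (hG : MemLp G 2 μ) :
    ∫ a, F a * G a ∂μ ≤ Real.sqrt (∫ a, F a ^ 2 ∂μ) * Real.sqrt (∫ a, G a ^ 2 ∂μ) := by
  have h2 : ENNReal.ofReal 2 = 2 := by simp
  have h := integral_mul_le_Lp_mul_Lq_of_nonneg Real.HolderConjugate.two_two hF0 hG0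
    (by rw [h2]; exact hF) (by rw [h2]; exact hG)
  simp only [Real.rpow_two] at h
  rw [Real.sqrt_eq_rpow, Real.sqrt_eq_rpow]
  exact h

/-! ### Step (i): Parseval for real Schwartz functions -/

/-- For real Schwartz `h, f` on `ℝ³`: `|∫ h f| ≤ ∫ ‖ĥ(ξ)‖ ‖f̂(ξ)‖ dξ`, by Plancherel for the
complexified test functions. [folklore] -/
theorem abs_integral_mul_le_integral_norm_fourier_mul
    (h f : 𝓢(EuclideanSpace ℝ (Fin 3), ℝ)) :
    |∫ x, h x * f x| ≤ ∫ ξ, ‖𝓕 (ofRealTest h) ξ‖ * ‖𝓕 (ofRealTest f) ξ‖ := by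
  have hP := SchwartzMap.integral_inner_fourier_fourier (ofRealTest h) (ofRealTest f)
  have hR : ∫ x, ⟪ofRealTest h x, ofRealTest f x⟫_ℂ = ((∫ x, h x * f x : ℝ) : ℂ) := by
    rw [← integral_complex_ofReal]
    refine integral_congr_ae (Eventually.of_forall fun x => ?_)
    simp only [ofRealTest_apply, RCLike.inner_apply, Complex.conj_ofReal, Complex.ofReal_mul]
    ring
  calc |∫ x, h x * f x| = ‖((∫ x, h x * f x : ℝ) : ℂ)‖ := by
        rw [Complex.norm_real, Real.norm_eq_abs]
    _ = ‖∫ ξ, ⟪𝓕 (ofRealTest h) ξ, 𝓕 (ofRealTest f) ξ⟫_ℂ‖ := by rw [← hR, hP]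
    _ ≤ ∫ ξ, ‖⟪𝓕 (ofRealTest h) ξ, 𝓕 (ofRealTest f) ξ⟫_ℂ‖ := norm_integral_le_integral_norm _
    _ = ∫ ξ, ‖𝓕 (ofRealTest h) ξ‖ * ‖𝓕 (ofRealTest f) ξ‖ := by
        refine integral_congr_ae (Eventually.of_forall fun ξ => ?_)
        simp only [RCLike.inner_apply, norm_mul, RCLike.norm_conj, mul_comm]

/-! ### Step (iii): the `H¹` side -/

/-- The square of the norm of a Schwartz map is integrable. [folklore] -/
theorem integrable_norm_sq_schwartz {F : Type*} [NormedAddCommGroup F] [NormedSpace ℝ F]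
    (g : 𝓢(EuclideanSpace ℝ (Fin 3), F)) : Integrable fun x => ‖g x‖ ^ 2 :=
  (memLp_two_iff_integrable_sq_norm g.continuous.aestronglyMeasurable).1 (g.memLp 2 _)

/-- The complexification commutes with directional derivatives:
`∂_m (h : ℂ-valued) x = ((D h x) m : ℂ)`. [folklore] -/
theorem lineDerivOp_ofRealTest_apply (h : 𝓢(EuclideanSpace ℝ (Fin 3), ℝ))
    (m x : EuclideanSpace ℝ (Fin 3)) :
    (∂_{m} (ofRealTest h)) x = ((fderiv ℝ (⇑h) x m : ℝ) : ℂ) := by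
  rw [SchwartzMap.lineDerivOp_apply_eq_fderiv]
  have hcomp : (⇑(ofRealTest h) : EuclideanSpace ℝ (Fin 3) → ℂ) = Complex.ofRealCLM ∘ ⇑h :=
    funext fun _ => rfl
  rw [hcomp, (Complex.ofRealCLM.hasFDerivAt.comp x (h.hasFDerivAt x)).fderiv]
  rfl

/-- **Plancherel with the symbol rule**: `∫ ‖ξ‖² ‖ĥ(ξ)‖² dξ ≤ ∫ ‖Dh(x)‖² dx` for a real Schwartz
`h` on `ℝ³` (in fact `= (4π²)⁻¹ Σⱼ ∫ (∂ⱼh)²`; Stein–Weiss I Thm. 1.8 and 2.3). [folklore] -/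
theorem integral_norm_sq_mul_norm_fourier_sq_le (h : 𝓢(EuclideanSpace ℝ (Fin 3), ℝ)) :
    Integrable (fun ξ => ‖ξ‖ ^ 2 * ‖𝓕 (ofRealTest h) ξ‖ ^ 2) ∧
      ∫ ξ, ‖ξ‖ ^ 2 * ‖𝓕 (ofRealTest h) ξ‖ ^ 2 ≤ ∫ x, ‖fderiv ℝ (⇑h) x‖ ^ 2 := by
  set b : OrthonormalBasis (Fin 3) ℝ (EuclideanSpace ℝ (Fin 3)) := EuclideanSpace.basisFun _ ℝ
  set hc : 𝓢(EuclideanSpace ℝ (Fin 3), ℂ) := ofRealTest h with hhc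
  -- the symbol rule, pointwise
  have hsym : ∀ (j : Fin 3) (ξ : EuclideanSpace ℝ (Fin 3)),
      ‖𝓕 (∂_{b j} hc) ξ‖ ^ 2 = (2 * π) ^ 2 * (⟪ξ, b j⟫_ℝ ^ 2 * ‖𝓕 hc ξ‖ ^ 2) := by
    intro j ξ
    have htemp : (fun x : EuclideanSpace ℝ (Fin 3) => ⟪x, b j⟫_ℝ).HasTemperateGrowth :=
      ((innerSL ℝ).flip (b j)).hasTemperateGrowth
    have hn : ‖(2 * (π : ℂ) * Complex.I)‖ = 2 * π := by
      rw [norm_mul, Complex.norm_I, mul_one, norm_mul, Complex.norm_real, RCLike.norm_ofNat,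
        Real.norm_eq_abs, abs_of_pos Real.pi_pos]
    rw [SchwartzMap.fourier_lineDerivOp_eq hc (b j), smul_apply,
      SchwartzMap.smulLeftCLM_apply_apply htemp, norm_smul, norm_smul, hn, Real.norm_eq_abs]
    simp only [mul_pow, sq_abs]
  have hkey : ∀ ξ : EuclideanSpace ℝ (Fin 3), ‖ξ‖ ^ 2 * ‖𝓕 hc ξ‖ ^ 2 =
      ((2 * π) ^ 2)⁻¹ * ∑ j, ‖𝓕 (∂_{b j} hc) ξ‖ ^ 2 := by
    intro ξ
    simp_rw [hsym, ← Finset.mul_sum, ← Finset.sum_mul, b.sum_sq_inner_left]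
    field_simp
  have hint : ∀ j : Fin 3, Integrable fun ξ => ‖𝓕 (∂_{b j} hc) ξ‖ ^ 2 := fun j =>
    integrable_norm_sq_schwartz _
  have hsumInt : Integrable fun ξ => ((2 * π) ^ 2)⁻¹ * ∑ j, ‖𝓕 (∂_{b j} hc) ξ‖ ^ 2 :=
    (integrable_finsetSum _ fun j _ => hint j).const_mul _
  have hI : Integrable (fun ξ => ‖ξ‖ ^ 2 * ‖𝓕 hc ξ‖ ^ 2) :=
    hsumInt.congr (Eventually.of_forall fun ξ => (hkey ξ).symm)
  refine ⟨hI, ?_⟩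
  -- integrability of `‖Dh‖²`
  have hDint : Integrable fun x => ‖fderiv ℝ (⇑h) x‖ ^ 2 :=
    integrable_norm_sq_schwartz (SchwartzMap.fderivCLM ℝ (EuclideanSpace ℝ (Fin 3)) ℝ h)
  -- each `∫ ‖𝓕(∂ⱼ h)‖² = ∫ (∂ⱼ h)² ≤ ∫ ‖Dh‖²`
  have hj : ∀ j : Fin 3, ∫ ξ, ‖𝓕 (∂_{b j} hc) ξ‖ ^ 2 ≤ ∫ x, ‖fderiv ℝ (⇑h) x‖ ^ 2 := by
    intro j
    rw [SchwartzMap.integral_norm_sq_fourier]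
    refine integral_mono (integrable_norm_sq_schwartz _) hDint fun x => ?_
    dsimp only
    rw [hhc, lineDerivOp_ofRealTest_apply, Complex.norm_real, Real.norm_eq_abs, sq_abs]
    have h1 : |fderiv ℝ (⇑h) x (b j)| ≤ ‖fderiv ℝ (⇑h) x‖ := by
      have := (fderiv ℝ (⇑h) x).le_opNorm (b j)
      rw [b.orthonormal.1 j, mul_one, Real.norm_eq_abs] at this
      exact this
    calc fderiv ℝ (⇑h) x (b j) ^ 2 = |fderiv ℝ (⇑h) x (b j)| ^ 2 := (sq_abs _).symm
      _ ≤ ‖fderiv ℝ (⇑h) x‖ ^ 2 := pow_le_pow_left₀ (abs_nonneg _) h1 2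
  have hD0 : 0 ≤ ∫ x, ‖fderiv ℝ (⇑h) x‖ ^ 2 := integral_nonneg fun x => by positivity
  have hπ : ((2 * π) ^ 2)⁻¹ * (3 * ∫ x, ‖fderiv ℝ (⇑h) x‖ ^ 2) ≤ ∫ x, ‖fderiv ℝ (⇑h) x‖ ^ 2 := by
    rw [← div_eq_inv_mul, div_le_iff₀ (by positivity)]
    have h3 : (3 : ℝ) ≤ (2 * π) ^ 2 := by nlinarith [Real.pi_gt_three]
    nlinarith
  calc ∫ ξ, ‖ξ‖ ^ 2 * ‖𝓕 hc ξ‖ ^ 2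
      = ∫ ξ, ((2 * π) ^ 2)⁻¹ * ∑ j, ‖𝓕 (∂_{b j} hc) ξ‖ ^ 2 :=
        integral_congr_ae (Eventually.of_forall hkey)
    _ = ((2 * π) ^ 2)⁻¹ * ∑ j, ∫ ξ, ‖𝓕 (∂_{b j} hc) ξ‖ ^ 2 := by
        rw [integral_const_mul, integral_finsetSum _ fun j _ => hint j]
    _ ≤ ((2 * π) ^ 2)⁻¹ * ∑ _j : Fin 3, ∫ x, ‖fderiv ℝ (⇑h) x‖ ^ 2 :=
        mul_le_mul_of_nonneg_left (Finset.sum_le_sum fun j _ => hj j) (by positivity)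
    _ = ((2 * π) ^ 2)⁻¹ * (3 * ∫ x, ‖fderiv ℝ (⇑h) x‖ ^ 2) := by
        rw [Finset.sum_const, Finset.card_univ, Fintype.card_fin, nsmul_eq_mul, Nat.cast_ofNat]
    _ ≤ ∫ x, ‖fderiv ℝ (⇑h) x‖ ^ 2 := hπ

/-- **The `H¹` side**: for `0 ≤ β ≤ 2` and a real Schwartz `h` on `ℝ³`,
`∫ ‖ξ‖^β ‖ĥ(ξ)‖² ≤ ∫ h² + ∫ ‖Dh‖²` (`‖ξ‖^β ≤ 1 + ‖ξ‖²`, Plancherel, and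
`integral_norm_sq_mul_norm_fourier_sq_le`). [folklore] -/
theorem integral_rpow_mul_norm_fourier_sq_le (h : 𝓢(EuclideanSpace ℝ (Fin 3), ℝ)) {β : ℝ}
    (hβ0 : 0 ≤ β) (hβ2 : β ≤ 2) :
    Integrable (fun ξ => ‖ξ‖ ^ β * ‖𝓕 (ofRealTest h) ξ‖ ^ 2) ∧
      ∫ ξ, ‖ξ‖ ^ β * ‖𝓕 (ofRealTest h) ξ‖ ^ 2 ≤
        (∫ x, (h x) ^ 2) + ∫ x, ‖fderiv ℝ (⇑h) x‖ ^ 2 := by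
  obtain ⟨hI2, hle2⟩ := integral_norm_sq_mul_norm_fourier_sq_le h
  have hI0 : Integrable fun ξ => ‖𝓕 (ofRealTest h) ξ‖ ^ 2 := integrable_norm_sq_schwartz _
  -- the pointwise weight bound `‖ξ‖^β ≤ 1 + ‖ξ‖²`
  have hw : ∀ ξ : EuclideanSpace ℝ (Fin 3), ‖ξ‖ ^ β ≤ 1 + ‖ξ‖ ^ 2 := by
    intro ξ
    rcases le_or_gt ‖ξ‖ 1 with h1 | h1
    · calc ‖ξ‖ ^ β ≤ 1 := Real.rpow_le_one (norm_nonneg _) h1 hβ0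
        _ ≤ 1 + ‖ξ‖ ^ 2 := le_add_of_nonneg_right (by positivity)
    · calc ‖ξ‖ ^ β ≤ ‖ξ‖ ^ (2 : ℝ) := Real.rpow_le_rpow_of_exponent_le h1.le hβ2
        _ = ‖ξ‖ ^ 2 := Real.rpow_two _
        _ ≤ 1 + ‖ξ‖ ^ 2 := le_add_of_nonneg_left zero_le_one
  have hpt : ∀ ξ : EuclideanSpace ℝ (Fin 3), ‖ξ‖ ^ β * ‖𝓕 (ofRealTest h) ξ‖ ^ 2 ≤
      ‖𝓕 (ofRealTest h) ξ‖ ^ 2 + ‖ξ‖ ^ 2 * ‖𝓕 (ofRealTest h) ξ‖ ^ 2 := by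
    intro ξ
    have h0 : 0 ≤ ‖𝓕 (ofRealTest h) ξ‖ ^ 2 := by positivity
    nlinarith [hw ξ]
  have hmeas : AEStronglyMeasurable (fun ξ => ‖ξ‖ ^ β * ‖𝓕 (ofRealTest h) ξ‖ ^ 2)
      (volume : Measure (EuclideanSpace ℝ (Fin 3))) :=
    ((continuous_norm.rpow_const fun _ => Or.inr hβ0).mul
      ((𝓕 (ofRealTest h)).continuous.norm.pow 2)).aestronglyMeasurable
  have hI : Integrable (fun ξ => ‖ξ‖ ^ β * ‖𝓕 (ofRealTest h) ξ‖ ^ 2) := by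
    refine (hI0.add hI2).mono' hmeas (Eventually.of_forall fun ξ => ?_)
    rw [Real.norm_eq_abs, abs_of_nonneg (by positivity)]
    exact hpt ξ
  refine ⟨hI, ?_⟩
  -- Plancherel for the zeroth-order term
  have hP : ∫ ξ, ‖𝓕 (ofRealTest h) ξ‖ ^ 2 = ∫ x, (h x) ^ 2 := by
    rw [SchwartzMap.integral_norm_sq_fourier]
    refine integral_congr_ae (Eventually.of_forall fun x => ?_)
    simp only [ofRealTest_apply, Complex.norm_real, Real.norm_eq_abs, sq_abs]
  calc ∫ ξ, ‖ξ‖ ^ β * ‖𝓕 (ofRealTest h) ξ‖ ^ 2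
      ≤ ∫ ξ, (‖𝓕 (ofRealTest h) ξ‖ ^ 2 + ‖ξ‖ ^ 2 * ‖𝓕 (ofRealTest h) ξ‖ ^ 2) :=
        integral_mono hI (hI0.add hI2) hpt
    _ = (∫ ξ, ‖𝓕 (ofRealTest h) ξ‖ ^ 2) + ∫ ξ, ‖ξ‖ ^ 2 * ‖𝓕 (ofRealTest h) ξ‖ ^ 2 :=
        integral_add hI0 hI2
    _ ≤ (∫ x, (h x) ^ 2) + ∫ x, ‖fderiv ℝ (⇑h) x‖ ^ 2 := by rw [hP]; gcongr

/-! ### Step (iv): the `Ḣ^{-s}` side -/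

/-- The spectral side of the Riesz pairing on the diagonal is the real integral
`∫ ‖ξ‖^{α−3} ‖f̂(ξ)‖²`. [folklore] -/
theorem re_integral_rpow_mul_fourier_mul_conj (f : 𝓢(EuclideanSpace ℝ (Fin 3), ℝ)) (α : ℝ) :
    (∫ ξ : EuclideanSpace ℝ (Fin 3), (((‖ξ‖ ^ (α - 3) : ℝ)) : ℂ) *
        (𝓕 (fun x => ((f x : ℝ) : ℂ)) ξ * conj (𝓕 (fun x => ((f x : ℝ) : ℂ)) ξ))).re =
      ∫ ξ, ‖ξ‖ ^ (α - 3) * ‖𝓕 (ofRealTest f) ξ‖ ^ 2 := by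
  have hfun : (fun ξ : EuclideanSpace ℝ (Fin 3) => (((‖ξ‖ ^ (α - 3) : ℝ)) : ℂ) *
      (𝓕 (fun x => ((f x : ℝ) : ℂ)) ξ * conj (𝓕 (fun x => ((f x : ℝ) : ℂ)) ξ))) =
      fun ξ => ((‖ξ‖ ^ (α - 3) * ‖𝓕 (ofRealTest f) ξ‖ ^ 2 : ℝ) : ℂ) := by
    funext ξ
    rw [Complex.mul_conj, Complex.normSq_eq_norm_sq]
    push_cast
    rfl
  rw [hfun, integral_complex_ofReal, Complex.ofReal_re]

/-! ### The stub -/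

/-- **Stub 3.2 (Sobolev–Riesz duality).**  For `1/2 < Δ ≤ 1` there is `C > 0` such that for all
real Schwartz `h, f` on `ℝ³`,
`|∫ h f| ≤ C (∫ h² + ∫ ‖Dh‖²)^{1/2} (∫∫ f(x)‖x−y‖^{-2Δ}f(y) dy dx)^{1/2}`
(the `H¹`–`Ḣ^{-s}` duality, `s = (3 − 2Δ)/2 ∈ [1/2, 1)`, the `Ḣ^{-s}` norm being the Riesz
energy by `Literature.Analysis.Potential.rieszKernel_fourier_pairing`). [folklore] -/
theorem stub_sobolev_riesz_duality :
    ∀ Δ : ℝ, 1 / 2 < Δ → Δ ≤ 1 → ∃ C : ℝ, 0 < C ∧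
      ∀ h f : SchwartzMap (EuclideanSpace ℝ (Fin 3)) ℝ,
        |∫ x, h x * f x| ≤
          C * Real.sqrt ((∫ x, (h x) ^ 2) + ∫ x, ‖fderiv ℝ (⇑h) x‖ ^ 2) *
            Real.sqrt (∫ x, ∫ y, f x * ‖x - y‖ ^ (-(2 * Δ)) * f y) := by
  intro Δ hΔ1 hΔ2
  set α : ℝ := 2 * Δ with hα
  have hα0 : 0 < α := by rw [hα]; linarith
  have hα3 : α < 3 := by rw [hα]; linarith
  obtain ⟨c, hc, hpair⟩ := Literature.Analysis.Potential.rieszKernel_fourier_pairing α hα0 hα3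
  refine ⟨(Real.sqrt c)⁻¹, inv_pos.2 (Real.sqrt_pos.2 hc), fun h f => ?_⟩
  -- notation
  set Hn : ℝ := (∫ x, (h x) ^ 2) + ∫ x, ‖fderiv ℝ (⇑h) x‖ ^ 2
  set K : ℝ := ∫ x, ∫ y, f x * ‖x - y‖ ^ (-α) * f y with hK
  set A : EuclideanSpace ℝ (Fin 3) → ℝ := fun ξ => ‖𝓕 (ofRealTest h) ξ‖
  set B : EuclideanSpace ℝ (Fin 3) → ℝ := fun ξ => ‖𝓕 (ofRealTest f) ξ‖
  set w : EuclideanSpace ℝ (Fin 3) → ℝ := fun ξ => Real.sqrt (‖ξ‖ ^ (3 - α)) with hw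
  have hA0 : ∀ ξ, 0 ≤ A ξ := fun ξ => norm_nonneg _
  have hB0 : ∀ ξ, 0 ≤ B ξ := fun ξ => norm_nonneg _
  have hw0 : ∀ ξ, 0 ≤ w ξ := fun ξ => Real.sqrt_nonneg _
  have hAc : Continuous A := (𝓕 (ofRealTest h)).continuous.norm
  have hBc : Continuous B := (𝓕 (ofRealTest f)).continuous.norm
  have hwc : Continuous w :=
    (continuous_norm.rpow_const fun _ => Or.inr (by linarith)).sqrt
  -- squares of the weighted functions
  have hsq1 : ∀ ξ, (A ξ * w ξ) ^ 2 = ‖ξ‖ ^ (3 - α) * ‖𝓕 (ofRealTest h) ξ‖ ^ 2 := by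
    intro ξ
    rw [mul_pow, hw, Real.sq_sqrt (Real.rpow_nonneg (norm_nonneg _) _), mul_comm]
  have hsq2 : ∀ ξ, (B ξ * (w ξ)⁻¹) ^ 2 = ‖ξ‖ ^ (α - 3) * ‖𝓕 (ofRealTest f) ξ‖ ^ 2 := by
    intro ξ
    rw [mul_pow, inv_pow, hw, Real.sq_sqrt (Real.rpow_nonneg (norm_nonneg _) _),
      ← Real.rpow_neg (norm_nonneg _), neg_sub, mul_comm]
  -- the `H¹` side
  obtain ⟨hI1, hle1⟩ := integral_rpow_mul_norm_fourier_sq_le h (β := 3 - α) (by linarith)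
    (by linarith)
  -- the `Ḣ^{-s}` side
  have hI2 : Integrable fun ξ => ‖ξ‖ ^ (α - 3) * ‖𝓕 (ofRealTest f) ξ‖ ^ 2 := by
    have := Literature.Analysis.Potential.integrable_norm_rpow_mul_norm_fourier_mul f f hα0 hα3
    refine this.congr (Eventually.of_forall fun ξ => ?_)
    simp only [sq]
    rfl
  have hKeq : K = c * ∫ ξ, ‖ξ‖ ^ (α - 3) * ‖𝓕 (ofRealTest f) ξ‖ ^ 2 := by
    rw [hK, hpair f f, re_integral_rpow_mul_fourier_mul_conj]
  have hJ0 : 0 ≤ ∫ ξ, ‖ξ‖ ^ (α - 3) * ‖𝓕 (ofRealTest f) ξ‖ ^ 2 :=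
    integral_nonneg fun ξ => by positivity
  -- Cauchy–Schwarz
  have hm1 : MemLp (fun ξ => A ξ * w ξ) 2 (volume : Measure (EuclideanSpace ℝ (Fin 3))) := by
    refine (memLp_two_iff_integrable_sq (hAc.mul hwc).aestronglyMeasurable).2 ?_
    exact hI1.congr (Eventually.of_forall fun ξ => (hsq1 ξ).symm)
  have hm2 : MemLp (fun ξ => B ξ * (w ξ)⁻¹) 2
      (volume : Measure (EuclideanSpace ℝ (Fin 3))) := by
    refine (memLp_two_iff_integrable_sq ?_).2 ?_
    · exact (hBc.measurable.mul hwc.measurable.inv).aestronglyMeasurable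
    · exact hI2.congr (Eventually.of_forall fun ξ => (hsq2 ξ).symm)
  have hCS := integral_mul_le_sqrt_mul_sqrt
    (μ := (volume : Measure (EuclideanSpace ℝ (Fin 3))))
    (Eventually.of_forall fun ξ => mul_nonneg (hA0 ξ) (hw0 ξ))
    (Eventually.of_forall fun ξ => mul_nonneg (hB0 ξ) (inv_nonneg.2 (hw0 ξ))) hm1 hm2
  -- `A B = (A w) (B w⁻¹)` almost everywhere (off the origin)
  have hae : (fun ξ => A ξ * B ξ) =ᵐ[(volume : Measure (EuclideanSpace ℝ (Fin 3)))]
      fun ξ => (A ξ * w ξ) * (B ξ * (w ξ)⁻¹) := by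
    filter_upwards [Measure.ae_ne volume (0 : EuclideanSpace ℝ (Fin 3))] with ξ hξ
    have hwpos : 0 < w ξ := Real.sqrt_pos.2 (Real.rpow_pos_of_pos (norm_pos_iff.2 hξ) _)
    field_simp
  -- assemble
  have hsqK : Real.sqrt (∫ ξ, ‖ξ‖ ^ (α - 3) * ‖𝓕 (ofRealTest f) ξ‖ ^ 2) =
      (Real.sqrt c)⁻¹ * Real.sqrt K := by
    rw [hKeq, Real.sqrt_mul' _ hJ0, ← mul_assoc, inv_mul_cancel₀ (Real.sqrt_pos.2 hc).ne',
      one_mul]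
  calc |∫ x, h x * f x| ≤ ∫ ξ, A ξ * B ξ := abs_integral_mul_le_integral_norm_fourier_mul h f
    _ = ∫ ξ, (A ξ * w ξ) * (B ξ * (w ξ)⁻¹) := integral_congr_ae hae
    _ ≤ Real.sqrt (∫ ξ, (A ξ * w ξ) ^ 2) * Real.sqrt (∫ ξ, (B ξ * (w ξ)⁻¹) ^ 2) := hCS
    _ = Real.sqrt (∫ ξ, ‖ξ‖ ^ (3 - α) * ‖𝓕 (ofRealTest h) ξ‖ ^ 2) *
          Real.sqrt (∫ ξ, ‖ξ‖ ^ (α - 3) * ‖𝓕 (ofRealTest f) ξ‖ ^ 2) := by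
        simp_rw [hsq1, hsq2]
    _ ≤ Real.sqrt Hn * ((Real.sqrt c)⁻¹ * Real.sqrt K) := by
        rw [hsqK]
        exact mul_le_mul_of_nonneg_right (Real.sqrt_le_sqrt hle1) (by positivity)
    _ = (Real.sqrt c)⁻¹ * Real.sqrt Hn * Real.sqrt K := by ring

end Summit.CriticalPhenomena.Ising3DConformalLimit.Cruxes.GaussianLimitIsFree.Birth

end
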